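import Summits.ValiantsHypothesis.ValiantsHypothesis.Theses.RealTau
import Literature.Computability.AlgebraicComplexity.RealTauKnownCases
import Summits.ValiantsHypothesis.ValiantsHypothesis.Theorems.RealTauRefined.Negative.Tightness

/-!
# `RealTau.RealTauRefined` (stmt-ValiantsHypothesis-18101) — negative side, III: `t` is load-bearing in the
# base; the additive count is attained on both Descartes faces, for all parameters

Refuter (cdisprove gen 2, cycle 1, 2026-08-17), from `Cruxes/RealTauRefined/Disproof.lean` Part III §(l)–(m);
companion of `Negative/LoadBearing.lean`, `Negative/Tightness.lean`, `Negative/AdditiveCount.lean`.  The crux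
(Tavenas 2014, Conj. 3.23: `#Z_ℝ(∑_{i<k} ∏_{j<m} f_ij) ≤ 2^(a(m+1)) (k+t+2)^a` for `t`-sparse real `f_ij`)
is an open conjecture and is NOT refuted here.  Certified (elementary; no facts, no `def`s):

* `realTauRefined_false_without_t` — the variant with `t` dropped from the base (bound `2^(a(m+1)) (k+2)^a`)
  is false: `k = m = 1`, one `(N+1)`-sparse `∏_{i<N} (X - i)`.  With `LoadBearing.lean` (sparsity, `2^m`,
  `k`): each of the four ingredients of the bound is necessary.
* `additiveCount_attained_m_one` — for ALL `k, t ≥ 1`: `∏_{i<kt-1} (X - (i+1))` cut into `k` blocks of `t`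
  consecutive monomials is a sum of `k` products of one `t`-sparse polynomial with `k t - 1 = k·1·(t-1) + k - 1`
  distinct zeros in `(0,∞)` (Descartes sharpness in the crux's own format; the instance `k = t = 12` is
  `Tightness.lean`'s `realTauRefined_bound_fails_at_one`).
* `additiveCount_attained_k_one` — for ALL `m` and `t ≥ 1`: one product of the `m` shifted polynomials
  `∏_{l<t-1} (X - (j(t-1)+l+1))` (degree `t - 1`, hence `t`-sparse) has `m (t-1) = 1·m·(t-1) + 1 - 1` distinct
  zeros in `(0,∞)` (Koiran's `k = 1` theorem is sharp in the crux's format).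
So any valid bound in the crux is `≥ max (k t - 1, m (t-1))` — both faces of the calibration "additive count"
`k m (t-1) + k - 1` of `Disproof.lean` §(k) (whose interaction term is certified at `(2,2,2)` in
`AdditiveCount.lean`). [folklore]
-/

set_option linter.dupNamespace false

namespace Summit.ValiantsHypothesis.ValiantsHypothesis.Theorems.RealTauRefined.Negative

open Polynomial Finset
open Literature.Computability.AlgebraicComplexity
open Summit.ValiantsHypothesis.ValiantsHypothesis.Theses.RealTau

/-! ### `t` is load-bearing in the base -/

/-- Any proof must let the bound grow with `t`: the variant of `RealTauRefined` with `t` dropped from the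
base is false — one `t`-sparse polynomial `∏_{i<N} (X - i)` (`k = m = 1`, `t = N + 1`, `N = 12^a + 1`) has
`N` distinct real zeros. [folklore] -/
theorem realTauRefined_false_without_t :
    ¬ ∃ a : ℕ, ∀ (k m t : ℕ) (f : Fin k → Fin m → Polynomial ℝ), (∀ i j, (f i j).support.card ≤ t) →
      (∑ i, ∏ j, f i j) ≠ 0 → (∑ i, ∏ j, f i j).roots.toFinset.card ≤ 2 ^ (a * (m + 1)) * (k + 2) ^ a := by
  rintro ⟨a, ha⟩
  set N : ℕ := 2 ^ (a * (1 + 1)) * (1 + 2) ^ a + 1 with hN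
  set s : Multiset ℝ := (Multiset.range N).map ((↑) : ℕ → ℝ) with hs
  set P : Polynomial ℝ := (s.map fun r => X - C r).prod with hP
  have hnd : s.Nodup := (Multiset.nodup_range N).map Nat.cast_injective
  have hsN : Multiset.card s = N := by rw [hs, Multiset.card_map, Multiset.card_range]
  have hcard : P.roots.toFinset.card = N := by
    rw [hP, roots_multiset_prod_X_sub_C, Multiset.toFinset_card_of_nodup hnd, hsN]
  have hP0 : P ≠ 0 := by
    rw [hP]; exact (monic_multiset_prod_of_monic _ _ fun r _ => monic_X_sub_C r).ne_zero
  have hdeg : P.natDegree = N := by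
    rw [hP, natDegree_multiset_prod_X_sub_C_eq_card, hsN]
  have hsupp : P.support.card ≤ N + 1 := (card_supp_le_succ_natDegree P).trans (by rw [hdeg])
  have key : (∑ _i : Fin 1, ∏ _j : Fin 1, P) = P := by simp
  have h := ha 1 1 (N + 1) (fun _ _ => P) (fun _ _ => hsupp) (by rw [key]; exact hP0)
  rw [key, hcard] at h
  omega

/-! ### the two Descartes faces of the additive count -/

/-- Face `m = 1` of `AdditiveCountAttained`, for ALL `k, t ≥ 1` (Descartes sharpness in the crux's own
format): `∏_{i<kt-1} (X - (i+1))`, cut into `k` blocks of `t` consecutive monomials, is a sum of `k`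
products of one `t`-sparse polynomial with `k t - 1 = k·1·(t-1) + k - 1` distinct zeros in `(0,∞)`.
Hence any valid bound in the crux is `≥ k t - 1` at `m = 1`. [folklore] -/
theorem additiveCount_attained_m_one (k t : ℕ) (hk : 1 ≤ k) (ht : 1 ≤ t) :
    ∃ f : Fin k → Fin 1 → Polynomial ℝ, (∀ i j, (f i j).support.card ≤ t) ∧ (∑ i, ∏ j, f i j) ≠ 0 ∧
      k * 1 * (t - 1) + k - 1 ≤ ((∑ i, ∏ j, f i j).roots.toFinset.filter (0 < ·)).card := by
  obtain ⟨n, rfl⟩ : ∃ n, t = n + 1 := ⟨t - 1, by omega⟩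
  set N : ℕ := k * n + k - 1 with hN
  set s : Multiset ℝ := (Multiset.range N).map (fun i : ℕ => (i : ℝ) + 1) with hs
  set P : Polynomial ℝ := (s.map fun r => X - C r).prod with hP
  have hinj : Function.Injective (fun i : ℕ => (i : ℝ) + 1) := fun a b h => by
    exact_mod_cast (add_right_cancel h : (a : ℝ) = b)
  have hnd : s.Nodup := (Multiset.nodup_range N).map hinj
  have hsN : Multiset.card s = N := by rw [hs, Multiset.card_map, Multiset.card_range]
  have hroots : P.roots = s := by rw [hP, roots_multiset_prod_X_sub_C]
  have hP0 : P ≠ 0 := by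
    rw [hP]; exact (monic_multiset_prod_of_monic _ _ fun r _ => monic_X_sub_C r).ne_zero
  have hdeg : P.natDegree = N := by
    rw [hP, natDegree_multiset_prod_X_sub_C_eq_card, hsN]
  have hlt : P.natDegree < k * (n + 1) := by
    rw [hdeg, hN, Nat.mul_succ]; omega
  have key : (∑ i : Fin k, ∏ _j : Fin 1,
      ∑ l : Fin (n + 1), C (P.coeff ((l : ℕ) + (n + 1) * (i : ℕ))) * X ^ ((l : ℕ) + (n + 1) * (i : ℕ)))
        = P := by
    simp only [Finset.prod_const, Finset.card_univ, Fintype.card_fin, pow_one]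
    exact sum_blocks_eq P k (n + 1) hlt
  refine ⟨fun i _ => ∑ l : Fin (n + 1), C (P.coeff ((l : ℕ) + (n + 1) * (i : ℕ))) *
      X ^ ((l : ℕ) + (n + 1) * (i : ℕ)),
    fun i _ => card_support_block_le P (n + 1) i, by rw [key]; exact hP0, ?_⟩
  rw [key]
  have hpos : ∀ x ∈ P.roots.toFinset, (0 : ℝ) < x := by
    intro x hx
    rw [hroots, Multiset.mem_toFinset, hs, Multiset.mem_map] at hx
    obtain ⟨i, -, rfl⟩ := hx
    positivity
  rw [Finset.filter_true_of_mem hpos, hroots, Multiset.toFinset_card_of_nodup hnd, hsN, hN]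
  simp only [mul_one, Nat.add_sub_cancel]
  exact le_rfl

/-- Face `k = 1` of `AdditiveCountAttained`, for ALL `m` and `t ≥ 1` (Koiran's `k = 1` theorem is sharp
in the crux's own format): one product of `m` polynomials of degree `t - 1`,
`f_j = ∏_{l<t-1} (X - (j(t-1)+l+1))`, has `m (t-1)` distinct zeros in `(0,∞)`.  Hence any valid bound
in the crux is `≥ m (t-1)` at `k = 1`. [folklore] -/
theorem additiveCount_attained_k_one (m t : ℕ) (ht : 1 ≤ t) :
    ∃ f : Fin 1 → Fin m → Polynomial ℝ, (∀ i j, (f i j).support.card ≤ t) ∧ (∑ i, ∏ j, f i j) ≠ 0 ∧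
      1 * m * (t - 1) + 1 - 1 ≤ ((∑ i, ∏ j, f i j).roots.toFinset.filter (0 < ·)).card := by
  obtain ⟨n, rfl⟩ : ∃ n, t = n + 1 := ⟨t - 1, by omega⟩
  simp only [Nat.add_sub_cancel, one_mul]
  -- the root used at position (j, l): r (l + n j) with r i = i + 1
  let r : ℕ → ℝ := fun i => (i : ℝ) + 1
  let g : Fin m → Polynomial ℝ := fun j => ∏ l : Fin n, (X - C (r ((l : ℕ) + n * (j : ℕ))))
  have hinj : Function.Injective r := fun a b h => by
    exact_mod_cast (add_right_cancel h : (a : ℝ) = b)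
  set s : Multiset ℝ := (Multiset.range (m * n)).map r with hs
  have hnd : s.Nodup := (Multiset.nodup_range _).map hinj
  have hsN : Multiset.card s = m * n := by rw [hs, Multiset.card_map, Multiset.card_range]
  -- ∏_j g j = ∏_{i < m n} (X - C (r i))
  have hprod : (∏ j : Fin m, g j) = (s.map fun x => X - C x).prod := by
    calc (∏ j : Fin m, g j) = ∏ x : Fin m × Fin n, (X - C (r ((x.2 : ℕ) + n * (x.1 : ℕ)))) :=
          (Fintype.prod_prod_type' _).symm
      _ = ∏ x : Fin m × Fin n, (fun i : Fin (m * n) => X - C (r (i : ℕ))) (finProdFinEquiv x) := rfl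
      _ = ∏ i : Fin (m * n), (X - C (r (i : ℕ))) :=
          Equiv.prod_comp finProdFinEquiv (fun i : Fin (m * n) => X - C (r (i : ℕ)))
      _ = ∏ i ∈ range (m * n), (X - C (r i)) := Fin.prod_univ_eq_prod_range (fun i => X - C (r i)) _
      _ = (s.map fun x => X - C x).prod := by
          rw [Finset.prod_eq_multiset_prod, Finset.range_val, hs, Multiset.map_map]; rfl
  have hP0 : (∏ j : Fin m, g j) ≠ 0 := by
    rw [hprod]; exact (monic_multiset_prod_of_monic _ _ fun x _ => monic_X_sub_C x).ne_zero
  have hroots : (∏ j : Fin m, g j).roots = s := by rw [hprod, roots_multiset_prod_X_sub_C]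
  have hsupp : ∀ j, (g j).support.card ≤ n + 1 := by
    intro j
    refine (card_supp_le_succ_natDegree _).trans ?_
    have : (g j).natDegree = n := by
      show (∏ l : Fin n, (X - C (r ((l : ℕ) + n * (j : ℕ))))).natDegree = n
      rw [natDegree_prod_of_monic _ _ fun l _ => monic_X_sub_C _]
      simp
    rw [this]
  have key : (∑ _i : Fin 1, ∏ j : Fin m, g j) = ∏ j : Fin m, g j := by simp
  refine ⟨fun _ j => g j, fun _ j => hsupp j, by rw [key]; exact hP0, ?_⟩
  rw [key]
  have hpos : ∀ x ∈ (∏ j : Fin m, g j).roots.toFinset, (0 : ℝ) < x := by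
    intro x hx
    rw [hroots, Multiset.mem_toFinset, hs, Multiset.mem_map] at hx
    obtain ⟨i, -, rfl⟩ := hx
    show (0 : ℝ) < (i : ℝ) + 1
    positivity
  rw [Finset.filter_true_of_mem hpos, hroots, Multiset.toFinset_card_of_nodup hnd, hsN]

end Summit.ValiantsHypothesis.ValiantsHypothesis.Theorems.RealTauRefined.Negative
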